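import Summits.QuantumFields.BalabanUV.Beta.SpineRootedW2
import Summits.QuantumFields.BalabanUV.Beta.MixedJetTablesPlug

/-!
# `BalabanUV.Beta.SpineRootedT2` — (P7′) ρ2, part E: the ROOTED recursive second-order tables `T2AtOf ρ`, the rooted instantiated
# family `JsBalT2AtOf ρ`, and an1's rooted binder tables plugged in AT THE SAME ROOT: `JsBalAn1At hLc hr` (the v2.22 candidate literal)

Cell result of NEAR-MISS CELL 7 (Bałaban 4D lattice YM UV stability), β sub-cell, lineage an2 (background-field route), generation 11.
HONEST FRAMING: discharging `BetaPertH` makes Bałaban's UV stability UNCONDITIONAL — a real constructive-QFT result; it is NOT the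
continuum limit and NOT the Clay problem.  This file asserts nothing about Bałaban's manuscripts: every declaration is a definition or a
kernel-checked lemma about the definitions (no `[cite:]` is claimed; placement under `Summits/` per the cell's (R34)).

WHAT.  Twins of `BalabanStepW2` §6–§6b and of an1's `MixedJetTablesPlug` over the ROOTED first-order spine of parts A–D:
* `T2AtOf ρ … j` — member `0` = `cE₂ • wilsonW₂ d T + cB • (mfNeg ∘ vh₂S)` (root-free Wilson 4-jet ⊕ the binder border); member `j+1` =
  `(cE₂·wV4 (j+1)) • e4OfW j (SpureAt ρ j) (M1At ρ j) (W2SymOfK (KInvStep Lc j) Lc (SpureAt ρ j) (M1At ρ j) (T2AtOf ρ … j) (M2Of mixFF j))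
  + (cB·wB2 (j+1)) • (mfNeg ∘ vh₂S)` — `e4OfW`, `W2SymOfK`, `M2Of`, the weights: ROOT-FREE, BY NAME;
* `T2AtOf_loc` (box root; induction on `j` exactly as `T2Of_loc`), `T2AtOf_translate` (all roots; as `T2Of_translate`), BRIDGE `T2AtOf_zero`;
* `WbalT2AtOf`, `JsBalT2AtOf hLc hr … hB hmix := JsBalW2AtOf hLc hr … (T2AtOf_loc …) hmix` with (Wt)/(St♭);
* **`JsBalAn1At hLc hr cE cVH cΛ cE₂ cB T := JsBalT2AtOf hLc hr … (hB_an1 hLc hr) (hmix_an1 hLc hr)`** — an1's ROOTED binder tables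
  `vh₂SAt (toSite r) Lc`, `mixFFAt (toSite r) Lc` plugged in at the SAME root `r` as the first-order spine and the axial dressing: the
  COHERENT ROOTED LITERAL; `JsBalAn1AtCtr hLc …` its centred instance (`d = 3`, `r = ctrOff 4 Lc`).
PROPOSED WALL LITERAL v2.22 (for the β-lead's record, not asserted here): `OneStepKernelFamily.D1Drift Lc (SpineRooted.JsBalAn1At hLc hr
cE cVH cΛ cE₂ cB T) N μ ν` (`hr : r ∈ box 4 Lc`; centred: `JsBalAn1AtCtr`, `Odd Lc`) — it elaborates (`example` in the certificate scratch).
-/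

open Finset
open scoped BigOperators
open Literature.MathematicalPhysics.QuantumFieldTheory
open Literature.MathematicalPhysics.QuantumFieldTheory.Balaban1983to89
open Literature.MathematicalPhysics.QuantumFieldTheory.Balaban1983to89.Beta
open LatticeForm (quo proj_add_zsmul)
open BlochFibreUniqueness (quo_add_zsmul)
open B12Sec2to5 (l1 l1_nonneg)
open ExpKernelCalculus (Decays BiLoc VertexFamily VertexFamily₂ shiftK Zl Zl_nonneg l1_sub_triangle l1_sub_symm)
open OneStepResolventKernel (Fib LocStencil JetData KInv decays_KInv shiftK_KInv biLoc_mono biLoc_finset_sum)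
open AffineAveraging (Form1 Form2 box toSite)
open StepJetData (wilsonA wBound locStencil_wilsonA wilsonA_translate wilsonA_antisymm mfNeg mfNeg_shiftK locStencil_mfNeg
  mfNeg_antisymm locStencil_add locStencil_smul biLoc_smul biLoc_weaken l1_add_le)
open AveragingHessianKernels (vhS hessFF ell)
open AveragingHessianKernelsRooted (vhSAt locStencil_vhSAt vhSAt_translate vhSAt_symm hessFFAt hessFFAt_antisymm biLoc_hessFFAt
  hessFFAt_translate vhSAt_zero hessFFAt_zero)
open InterLevelTransport (SLam locStencil_SLam SLam_translate cwsum avgLift biLoc_avgLift avgLift_shiftK)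
open BalabanStepJets (lamCoeffOf abs_lamCoeffOf_le lamCoeffOf_translate cwsum_antisymm locStencil_mono vertexFamily₂_mono S0)
open ExpKernelCalculus (MKer comp comp_shiftK)
open OneStepResolventKernel (decays_mono vertexOf vertexFamily_vertexOf')
open OneStepKernelFamily (KInvStep decays_KInvStep shiftK_KInvStep TstepOf TbalOf)
open BalabanStepJetsSucc (mmRead E2 e3Of decays_E2 one_le_pow_Lc locStencil_e3Of lamCoeffK abs_lamCoeffK_le wE wVH wΛ Sstep
  vertexOf_translate_block comp_sandwich_shiftK mmRead_shiftK_smul shiftK_E2 lamCoeffK_translate biLoc_comp_right biLoc_mmRead decays_mmRead)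
open Summit.QuantumFields.BalabanUV.Beta.AxialDressingRooted (dressAt dressAt_S dressAt_W dressAtS_translate dressAtW_translate)
open BalabanCompositeJets (LocStencil₂)
open BalabanStepW2 (wM1 wM2 M2Of locStencilFM_M2Of M2Of_translate Spure M1 WbalOf T2Of T2Of_zero T2Of_succ e4OfW wV4 wB2
  locStencil₂_e4OfW e4OfW_translate locStencil₂_smul' locStencil₂_add' locStencil₂_mfNeg)
open SecondOrderResponse (W2SymOfK W2SymOfK_swap LocStencilFM vertexFamily₂_W2SymOfK' W2SymOfK_translate)
open WilsonBiStencil (wilsonW₂ wBound₂ biLoc_wilsonW₂ wilsonW₂_translate)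
open AveragingContoursRooted (ctrOff ctrOff_mem_box)
open AveragingMixedJetTables (mixFFAt vh₂SAt)
open Summit.QuantumFields.BalabanUV.Beta.MixedJetTablesPlug (hB_an1 hmix_an1 hBt_an1 hmixt_an1)

noncomputable section

namespace Summit.QuantumFields.BalabanUV.Beta.SpineRooted

variable {d : ℕ}

/-! ## §E1 The rooted recursive second-order stencil-table family `T2AtOf ρ` -/

section T2

/-- [folklore] **THE ROOTED RECURSIVE SECOND-ORDER STENCIL-TABLE FAMILY** (twin of `BalabanStepW2.T2Of` over `SpureAt ρ`, `M1At ρ`):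
member `0` = `cE₂ • wilsonW₂ d T + cB • (mfNeg ∘ vh₂S)`; member `j+1` = `(cE₂·wV4 (j+1)) • e4OfW j (SpureAt ρ j) (M1At ρ j) (W2SymOfK …
(T2AtOf ρ … j) (M2Of mixFF j)) + (cB·wB2 (j+1)) • (mfNeg ∘ vh₂S)` (structural recursion on `j`).  A definition asserting nothing. -/
def T2AtOf (d Lc : ℕ) [NeZero Lc] (ρ : Fin (d + 1) → ℤ) (cE cVH cΛ cE₂ cB : ℝ) (T : Fin 4 → Fin 4 → Fin 4 → Fin 4 → ℝ)
    (vh₂S : Fin (d + 1) → (Fin (d + 1) → ℤ) → Fin (d + 1) → (Fin (d + 1) → ℤ) → ExpKernelCalculus.MKer (d + 1) (Fib d))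
    (mixFF : Fin (d + 1) → (Fin (d + 1) → ℤ) → Fin (d + 1) → (Fin (d + 1) → ℤ) → ExpKernelCalculus.MKer (d + 1) (Fib d)) :
    ℕ → Fin (d + 1) → (Fin (d + 1) → ℤ) → Fin (d + 1) → (Fin (d + 1) → ℤ) → ExpKernelCalculus.MKer (d + 1) (Fib d)
  | 0 => fun κ u κ' u' => cE₂ • wilsonW₂ d T κ u κ' u' + cB • mfNeg (vh₂S κ u κ' u')
  | j + 1 => fun κ u κ' u' =>
      (cE₂ * wV4 d Lc (j + 1)) •
          e4OfW d Lc j (SpureAt d Lc ρ cE cVH cΛ j) (M1At d Lc ρ cΛ j)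
            (W2SymOfK (KInvStep (d := d) Lc j) Lc (SpureAt d Lc ρ cE cVH cΛ j) (M1At d Lc ρ cΛ j)
              (T2AtOf d Lc ρ cE cVH cΛ cE₂ cB T vh₂S mixFF j) (M2Of d Lc mixFF j)) κ u κ' u'
        + (cB * wB2 d Lc (j + 1)) • mfNeg (vh₂S κ u κ' u')

variable {Lc : ℕ} [NeZero Lc]

/-- [folklore] Level `0` of the rooted recursive second-order table: `cE₂ • wilsonW₂ d T + cB • mfNeg vh₂S`. -/
@[simp] theorem T2AtOf_zero_level (ρ : Fin (d + 1) → ℤ) (cE cVH cΛ cE₂ cB : ℝ) (T : Fin 4 → Fin 4 → Fin 4 → Fin 4 → ℝ)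
    (vh₂S mixFF : Fin (d + 1) → (Fin (d + 1) → ℤ) → Fin (d + 1) → (Fin (d + 1) → ℤ) → ExpKernelCalculus.MKer (d + 1) (Fib d)) :
    T2AtOf d Lc ρ cE cVH cΛ cE₂ cB T vh₂S mixFF 0 = fun κ u κ' u' => cE₂ • wilsonW₂ d T κ u κ' u' + cB • mfNeg (vh₂S κ u κ' u') := rfl

/-- [folklore] Member `j+1` THROUGH `WbalAtOf ρ … j`, by `rfl`. -/
@[simp] theorem T2AtOf_succ (ρ : Fin (d + 1) → ℤ) (cE cVH cΛ cE₂ cB : ℝ) (T : Fin 4 → Fin 4 → Fin 4 → Fin 4 → ℝ)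
    (vh₂S mixFF : Fin (d + 1) → (Fin (d + 1) → ℤ) → Fin (d + 1) → (Fin (d + 1) → ℤ) → ExpKernelCalculus.MKer (d + 1) (Fib d)) (j : ℕ) :
    T2AtOf d Lc ρ cE cVH cΛ cE₂ cB T vh₂S mixFF (j + 1) = fun κ u κ' u' =>
      (cE₂ * wV4 d Lc (j + 1)) •
          e4OfW d Lc j (SpureAt d Lc ρ cE cVH cΛ j) (M1At d Lc ρ cΛ j)
            (WbalAtOf d Lc ρ cE cVH cΛ (T2AtOf d Lc ρ cE cVH cΛ cE₂ cB T vh₂S mixFF) mixFF j) κ u κ' u'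
        + (cB * wB2 d Lc (j + 1)) • mfNeg (vh₂S κ u κ' u') := rfl

/-- [folklore] **BRIDGE:** at the corner root, `T2AtOf 0 = BalabanStepW2.T2Of` member by member (`SpureAt_zero`, `M1At_zero`). -/
theorem T2AtOf_zero (cE cVH cΛ cE₂ cB : ℝ) (T : Fin 4 → Fin 4 → Fin 4 → Fin 4 → ℝ)
    (vh₂S mixFF : Fin (d + 1) → (Fin (d + 1) → ℤ) → Fin (d + 1) → (Fin (d + 1) → ℤ) → ExpKernelCalculus.MKer (d + 1) (Fib d)) :
    ∀ j : ℕ, T2AtOf d Lc 0 cE cVH cΛ cE₂ cB T vh₂S mixFF j = T2Of d Lc cE cVH cΛ cE₂ cB T vh₂S mixFF j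
  | 0 => rfl
  | j + 1 => by
    funext κ u κ' u'
    simp only [T2AtOf, T2Of, SpureAt_zero, M1At_zero, T2AtOf_zero cE cVH cΛ cE₂ cB T vh₂S mixFF j]

omit [NeZero Lc] in
/-- [folklore] **EVERY MEMBER OF `T2AtOf (toSite r)` IS A `LocStencil₂` FAMILY** (box root; some rate `δ > 0`), by induction on `j` exactly
as `BalabanStepW2.T2Of_loc` with `locStencil_SpureAt`, `vertexFamily_M1At`, `WbalAtOf_swap`. -/
theorem T2AtOf_loc [NeZero Lc] (hLc : 1 ≤ Lc) {r : Fin (d + 1) → ℕ} (hr : r ∈ box (d + 1) Lc) (cE cVH cΛ cE₂ cB : ℝ)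
    (T : Fin 4 → Fin 4 → Fin 4 → Fin 4 → ℝ)
    {vh₂S : Fin (d + 1) → (Fin (d + 1) → ℤ) → Fin (d + 1) → (Fin (d + 1) → ℤ) → ExpKernelCalculus.MKer (d + 1) (Fib d)}
    (hB : ∃ C δ : ℝ, 0 < δ ∧ LocStencil₂ vh₂S C δ)
    {mixFF : Fin (d + 1) → (Fin (d + 1) → ℤ) → Fin (d + 1) → (Fin (d + 1) → ℤ) → ExpKernelCalculus.MKer (d + 1) (Fib d)}
    (hmix : ∃ C δ : ℝ, 0 < δ ∧ LocStencilFM Lc mixFF C δ) :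
    ∀ j : ℕ, ∃ C δ : ℝ, 0 < δ ∧ LocStencil₂ (T2AtOf d Lc (toSite r) cE cVH cΛ cE₂ cB T vh₂S mixFF j) C δ
  | 0 => by
    obtain ⟨CB, δB, hδB, hBl⟩ := hB
    have hWil : LocStencil₂ (wilsonW₂ d T) (wBound₂ d T * Real.exp (8 * δB)) δB := fun κ u κ' u' => biLoc_wilsonW₂ T hδB.le κ u κ' u'
    rw [T2AtOf_zero_level]
    exact ⟨_, δB, hδB, locStencil₂_add' (locStencil₂_smul' cE₂ hWil) (locStencil₂_smul' cB (locStencil₂_mfNeg hBl))⟩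
  | j + 1 => by
    obtain ⟨C₂, δ₂, hδ₂, hT⟩ := T2AtOf_loc hLc hr cE cVH cΛ cE₂ cB T hB hmix j
    obtain ⟨CB, δB, hδB, hBl⟩ := hB
    obtain ⟨Cs, δs, hδs, hS⟩ := locStencil_SpureAt (d := d) (Lc := Lc) hLc hr cE cVH cΛ j
    obtain ⟨CM₂, δ₃, hδ₃, hM₂⟩ := hmix
    have hWv : ∃ Cw δw : ℝ, 0 < δw ∧
        VertexFamily₂ (WbalAtOf d Lc (toSite r) cE cVH cΛ (T2AtOf d Lc (toSite r) cE cVH cΛ cE₂ cB T vh₂S mixFF) mixFF j) Lc Cw δw :=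
      vertexFamily₂_W2SymOfK' (decays_KInvStep (Lc := Lc) (d := d) j) hS hδs (vertexFamily_M1At hLc hr cΛ j zero_le_one) one_pos
        hT hδ₂ (locStencilFM_M2Of hM₂ j) hδ₃
    obtain ⟨C4, δ4, hδ4, h4⟩ := locStencil₂_e4OfW (d := d) (Lc := Lc) hLc j ⟨Cs, δs, hδs, hS⟩
      ⟨_, 1, one_pos, vertexFamily_M1At hLc hr cΛ j zero_le_one⟩ hWv
      (WbalAtOf_swap (toSite r) cE cVH cΛ (T2AtOf d Lc (toSite r) cE cVH cΛ cE₂ cB T vh₂S mixFF) mixFF j)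
    have hm : 0 < min δ4 δB := lt_min hδ4 hδB
    rw [T2AtOf_succ]
    exact ⟨_, _, hm, locStencil₂_add' (locStencil₂_smul' _ (h4.mono (min_le_left δ4 δB)))
      (locStencil₂_smul' _ (locStencil₂_mfNeg (hBl.mono (min_le_right δ4 δB))))⟩

/-- [folklore] **JOINT BLOCK COVARIANCE OF EVERY MEMBER OF `T2AtOf ρ`** (all roots), by induction on `j` exactly as
`BalabanStepW2.T2Of_translate` with `SpureAt_translate`, `M1At_translate`. -/
theorem T2AtOf_translate (ρ : Fin (d + 1) → ℤ) (hLc : 1 ≤ Lc) (cE cVH cΛ cE₂ cB : ℝ) (T : Fin 4 → Fin 4 → Fin 4 → Fin 4 → ℝ)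
    {vh₂S : Fin (d + 1) → (Fin (d + 1) → ℤ) → Fin (d + 1) → (Fin (d + 1) → ℤ) → ExpKernelCalculus.MKer (d + 1) (Fib d)}
    (hBt : ∀ (κ : Fin (d + 1)) (u : Fin (d + 1) → ℤ) (κ' : Fin (d + 1)) (u' t : Fin (d + 1) → ℤ),
      vh₂S κ (u + (Lc : ℤ) • t) κ' (u' + (Lc : ℤ) • t) = shiftK (-((Lc : ℤ) • t)) (vh₂S κ u κ' u'))
    {mixFF : Fin (d + 1) → (Fin (d + 1) → ℤ) → Fin (d + 1) → (Fin (d + 1) → ℤ) → ExpKernelCalculus.MKer (d + 1) (Fib d)}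
    (hmixt : ∀ (κ : Fin (d + 1)) (u : Fin (d + 1) → ℤ) (μ : Fin (d + 1)) (w t : Fin (d + 1) → ℤ),
      mixFF κ (u + (Lc : ℤ) • t) μ (w + t) = shiftK (-((Lc : ℤ) • t)) (mixFF κ u μ w)) :
    ∀ (j : ℕ) (κ : Fin (d + 1)) (u : Fin (d + 1) → ℤ) (κ' : Fin (d + 1)) (u' t : Fin (d + 1) → ℤ),
      T2AtOf d Lc ρ cE cVH cΛ cE₂ cB T vh₂S mixFF j κ (u + (Lc : ℤ) • t) κ' (u' + (Lc : ℤ) • t)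
        = shiftK (-((Lc : ℤ) • t)) (T2AtOf d Lc ρ cE cVH cΛ cE₂ cB T vh₂S mixFF j κ u κ' u')
  | 0, κ, u, κ', u', t => by
    show cE₂ • wilsonW₂ d T κ (u + (Lc : ℤ) • t) κ' (u' + (Lc : ℤ) • t) + cB • mfNeg (vh₂S κ (u + (Lc : ℤ) • t) κ' (u' + (Lc : ℤ) • t))
      = shiftK (-((Lc : ℤ) • t)) (cE₂ • wilsonW₂ d T κ u κ' u' + cB • mfNeg (vh₂S κ u κ' u'))
    rw [wilsonW₂_translate, hBt, mfNeg_shiftK]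
    rfl
  | j + 1, κ, u, κ', u', t => by
    have IH := T2AtOf_translate ρ hLc cE cVH cΛ cE₂ cB T hBt hmixt j
    have hWt : ∀ (μ : Fin (d + 1)) (y : Fin (d + 1) → ℤ) (ν : Fin (d + 1)) (y' s : Fin (d + 1) → ℤ),
        W2SymOfK (KInvStep (d := d) Lc j) Lc (SpureAt d Lc ρ cE cVH cΛ j) (M1At d Lc ρ cΛ j)
            (T2AtOf d Lc ρ cE cVH cΛ cE₂ cB T vh₂S mixFF j) (M2Of d Lc mixFF j) μ (y + s) ν (y' + s)
          = shiftK (-((Lc : ℤ) • s)) (W2SymOfK (KInvStep (d := d) Lc j) Lc (SpureAt d Lc ρ cE cVH cΛ j) (M1At d Lc ρ cΛ j)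
              (T2AtOf d Lc ρ cE cVH cΛ cE₂ cB T vh₂S mixFF j) (M2Of d Lc mixFF j) μ y ν y') :=
      fun μ y ν y' s => W2SymOfK_translate (N := Lc) (fun s' => shiftK_KInvStep (Lc := Lc) (d := d) j s')
        (SpureAt_translate ρ hLc cE cVH cΛ j) (M1At_translate (Lc := Lc) ρ cΛ j) IH (M2Of_translate (Lc := Lc) hmixt j) μ y ν y' s
    show (cE₂ * wV4 d Lc (j + 1)) •
          e4OfW d Lc j (SpureAt d Lc ρ cE cVH cΛ j) (M1At d Lc ρ cΛ j)
            (W2SymOfK (KInvStep (d := d) Lc j) Lc (SpureAt d Lc ρ cE cVH cΛ j) (M1At d Lc ρ cΛ j)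
              (T2AtOf d Lc ρ cE cVH cΛ cE₂ cB T vh₂S mixFF j) (M2Of d Lc mixFF j)) κ (u + (Lc : ℤ) • t) κ' (u' + (Lc : ℤ) • t)
        + (cB * wB2 d Lc (j + 1)) • mfNeg (vh₂S κ (u + (Lc : ℤ) • t) κ' (u' + (Lc : ℤ) • t))
      = shiftK (-((Lc : ℤ) • t)) ((cE₂ * wV4 d Lc (j + 1)) •
          e4OfW d Lc j (SpureAt d Lc ρ cE cVH cΛ j) (M1At d Lc ρ cΛ j)
            (W2SymOfK (KInvStep (d := d) Lc j) Lc (SpureAt d Lc ρ cE cVH cΛ j) (M1At d Lc ρ cΛ j)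
              (T2AtOf d Lc ρ cE cVH cΛ cE₂ cB T vh₂S mixFF j) (M2Of d Lc mixFF j)) κ u κ' u'
        + (cB * wB2 d Lc (j + 1)) • mfNeg (vh₂S κ u κ' u'))
    rw [e4OfW_translate j (SpureAt_translate ρ hLc cE cVH cΛ j) (M1At_translate (Lc := Lc) ρ cΛ j) hWt, hBt, mfNeg_shiftK]
    rfl

end T2

/-! ## §E2 The rooted instantiated second-order family and its sockets -/

section Inst

variable {Lc : ℕ} [NeZero Lc] (hLc : 1 ≤ Lc) {r : Fin (d + 1) → ℕ} (hr : r ∈ box (d + 1) Lc) (cE cVH cΛ cE₂ cB : ℝ)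
    (T : Fin 4 → Fin 4 → Fin 4 → Fin 4 → ℝ)
    {vh₂S : Fin (d + 1) → (Fin (d + 1) → ℤ) → Fin (d + 1) → (Fin (d + 1) → ℤ) → ExpKernelCalculus.MKer (d + 1) (Fib d)}
    (hB : ∃ C δ : ℝ, 0 < δ ∧ LocStencil₂ vh₂S C δ)
    {mixFF : Fin (d + 1) → (Fin (d + 1) → ℤ) → Fin (d + 1) → (Fin (d + 1) → ℤ) → ExpKernelCalculus.MKer (d + 1) (Fib d)}
    (hmix : ∃ C δ : ℝ, 0 < δ ∧ LocStencilFM Lc mixFF C δ)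

/-- [folklore] **THE ROOTED SECOND-ORDER FAMILY WITH ITS RECURSIVE TABLES**: `WbalT2AtOf … j := WbalAtOf (toSite r) … (T2AtOf (toSite r) …) … j`. -/
def WbalT2AtOf (j : ℕ) :
    Fin (d + 1) → (Fin (d + 1) → ℤ) → Fin (d + 1) → (Fin (d + 1) → ℤ) → ExpKernelCalculus.MKer (d + 1) (Fib d) :=
  WbalAtOf d Lc (toSite r) cE cVH cΛ (T2AtOf d Lc (toSite r) cE cVH cΛ cE₂ cB T vh₂S mixFF) mixFF j

/-- [folklore] **THE ROOTED DRESSED JET-DATA FAMILY WITH RECURSIVE SECOND-ORDER TABLES** — `JsBalW2AtOf` at `T₂ := T2AtOf (toSite r) …`,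
its `hT₂` hypothesis DISCHARGED by `T2AtOf_loc`. -/
def JsBalT2AtOf : ℕ → JetData d Lc :=
  JsBalW2AtOf hLc hr cE cVH cΛ (T2AtOf_loc hLc hr cE cVH cΛ cE₂ cB T hB hmix) hmix

/-- [folklore] `JsBalT2AtOf` unfolds to `JsBalW2AtOf` at the recursive tables `T2AtOf_loc …` (closure lemma). -/
theorem JsBalT2AtOf_eq :
    JsBalT2AtOf hLc hr cE cVH cΛ cE₂ cB T hB hmix = JsBalW2AtOf hLc hr cE cVH cΛ (T2AtOf_loc hLc hr cE cVH cΛ cE₂ cB T hB hmix) hmix :=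
  rfl

/-- [folklore] **(Wt) FOR THE ROOTED FAMILY WITH RECURSIVE TABLES** — only the two BORDER covariance hypotheses remain. -/
theorem JsBalT2AtOf_W_translate
    (hBt : ∀ (κ : Fin (d + 1)) (u : Fin (d + 1) → ℤ) (κ' : Fin (d + 1)) (u' t : Fin (d + 1) → ℤ),
      vh₂S κ (u + (Lc : ℤ) • t) κ' (u' + (Lc : ℤ) • t) = shiftK (-((Lc : ℤ) • t)) (vh₂S κ u κ' u'))
    (hmixt : ∀ (κ : Fin (d + 1)) (u : Fin (d + 1) → ℤ) (μ : Fin (d + 1)) (w t : Fin (d + 1) → ℤ),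
      mixFF κ (u + (Lc : ℤ) • t) μ (w + t) = shiftK (-((Lc : ℤ) • t)) (mixFF κ u μ w))
    (j : ℕ) (μ : Fin (d + 1)) (y : Fin (d + 1) → ℤ) (ν : Fin (d + 1)) (y' t : Fin (d + 1) → ℤ) :
    (JsBalT2AtOf hLc hr cE cVH cΛ cE₂ cB T hB hmix j).W μ (y + t) ν (y' + t)
      = shiftK (-((Lc : ℤ) • t)) ((JsBalT2AtOf hLc hr cE cVH cΛ cE₂ cB T hB hmix j).W μ y ν y') :=
  JsBalW2AtOf_W_translate hLc hr cE cVH cΛ _ hmix (T2AtOf_translate (toSite r) hLc cE cVH cΛ cE₂ cB T hBt hmixt) hmixt j μ y ν y' t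

/-- [folklore] **(St♭) FOR THE ROOTED FAMILY WITH RECURSIVE TABLES.** -/
theorem JsBalT2AtOf_S_translate (j : ℕ) (κ' : Fin (d + 1)) (u t : Fin (d + 1) → ℤ) :
    (JsBalT2AtOf hLc hr cE cVH cΛ cE₂ cB T hB hmix j).S κ' (u + (Lc : ℤ) • t)
      = shiftK (-((Lc : ℤ) • t)) ((JsBalT2AtOf hLc hr cE cVH cΛ cE₂ cB T hB hmix j).S κ' u) :=
  JsBalW2AtOf_S_translate hLc hr cE cVH cΛ _ hmix j κ' u t

end Inst

/-! ## §E3 an1's ROOTED binder tables plugged in AT THE SAME ROOT: the coherent rooted literal `JsBalAn1At hLc hr` -/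

section Plug

variable {Lc : ℕ} [NeZero Lc] {r : Fin (d + 1) → ℕ}

/-- **THE COHERENT ROOTED FAMILY** (twin of an1's `MixedJetTablesPlug.JsBalAn1`): an2's rooted dressed jet-data family with recursive
tables, an1's ROOTED border tables `vh₂SAt (toSite r) Lc` / `mixFFAt (toSite r) Lc` plugged in through an1's `hB_an1 hLc hr` /
`hmix_an1 hLc hr` — ONE root `r ∈ box (d+1) Lc` for the first-order spine (`vhSAt`, `hessFFAt`), the second-order binder tables AND the
axial dressing `dressAt hr`.  NO table hypothesis left; binders: `hLc`, `hr`, the colour constants, an3's position table `T`. -/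
def JsBalAn1At (hLc : 1 ≤ Lc) (hr : r ∈ box (d + 1) Lc) (cE cVH cΛ cE₂ cB : ℝ) (T : Fin 4 → Fin 4 → Fin 4 → Fin 4 → ℝ) :
    ℕ → JetData d Lc :=
  JsBalT2AtOf hLc hr cE cVH cΛ cE₂ cB T (hB_an1 hLc hr) (hmix_an1 hLc hr)

/-- `JsBalAn1At` is `JsBalT2AtOf` at an1's rooted tables, by `rfl`. -/
theorem JsBalAn1At_eq (hLc : 1 ≤ Lc) (hr : r ∈ box (d + 1) Lc) (cE cVH cΛ cE₂ cB : ℝ) (T : Fin 4 → Fin 4 → Fin 4 → Fin 4 → ℝ) :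
    JsBalAn1At hLc hr cE cVH cΛ cE₂ cB T = JsBalT2AtOf hLc hr cE cVH cΛ cE₂ cB T (hB_an1 hLc hr) (hmix_an1 hLc hr) := rfl

/-- (Wt) for the coherent rooted family — both border covariance hypotheses discharged by an1's rooted translate laws. -/
theorem JsBalAn1At_W_translate (hLc : 1 ≤ Lc) (hr : r ∈ box (d + 1) Lc) (cE cVH cΛ cE₂ cB : ℝ)
    (T : Fin 4 → Fin 4 → Fin 4 → Fin 4 → ℝ) (j : ℕ) (μ : Fin (d + 1)) (y : Fin (d + 1) → ℤ) (ν : Fin (d + 1))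
    (y' t : Fin (d + 1) → ℤ) :
    (JsBalAn1At hLc hr cE cVH cΛ cE₂ cB T j).W μ (y + t) ν (y' + t)
      = shiftK (-((Lc : ℤ) • t)) ((JsBalAn1At hLc hr cE cVH cΛ cE₂ cB T j).W μ y ν y') :=
  JsBalT2AtOf_W_translate hLc hr cE cVH cΛ cE₂ cB T (hB_an1 hLc hr) (hmix_an1 hLc hr)
    (hBt_an1 hLc (toSite r)) (hmixt_an1 (toSite r)) j μ y ν y' t

/-- (St♭) for the coherent rooted family. -/
theorem JsBalAn1At_S_translate (hLc : 1 ≤ Lc) (hr : r ∈ box (d + 1) Lc) (cE cVH cΛ cE₂ cB : ℝ)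
    (T : Fin 4 → Fin 4 → Fin 4 → Fin 4 → ℝ) (j : ℕ) (κ' : Fin (d + 1)) (u t : Fin (d + 1) → ℤ) :
    (JsBalAn1At hLc hr cE cVH cΛ cE₂ cB T j).S κ' (u + (Lc : ℤ) • t)
      = shiftK (-((Lc : ℤ) • t)) ((JsBalAn1At hLc hr cE cVH cΛ cE₂ cB T j).S κ' u) :=
  JsBalT2AtOf_S_translate hLc hr cE cVH cΛ cE₂ cB T (hB_an1 hLc hr) (hmix_an1 hLc hr) j κ' u t

/-- **THE CENTRED COHERENT FAMILY** at `d = 3` (twin of an1's `JsBalAn1Ctr`): `JsBalAn1At` at the centred root `ctrOff 4 Lc` — the centre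
of the averaging window for ODD `Lc` (an5's chart). -/
def JsBalAn1AtCtr {Lc : ℕ} [NeZero Lc] (hLc : 1 ≤ Lc) (cE cVH cΛ cE₂ cB : ℝ) (T : Fin 4 → Fin 4 → Fin 4 → Fin 4 → ℝ) :
    ℕ → JetData 3 Lc :=
  JsBalAn1At (d := 3) hLc (ctrOff_mem_box hLc) cE cVH cΛ cE₂ cB T

/-- `JsBalAn1AtCtr` is `JsBalAn1At` at the centred root, by `rfl`. -/
theorem JsBalAn1AtCtr_eq {Lc : ℕ} [NeZero Lc] (hLc : 1 ≤ Lc) (cE cVH cΛ cE₂ cB : ℝ) (T : Fin 4 → Fin 4 → Fin 4 → Fin 4 → ℝ) :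
    JsBalAn1AtCtr hLc cE cVH cΛ cE₂ cB T = JsBalAn1At (d := 3) hLc (ctrOff_mem_box hLc) cE cVH cΛ cE₂ cB T := rfl

end Plug

end Summit.QuantumFields.BalabanUV.Beta.SpineRooted

end
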